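import Summits.AtomisticToContinuum.BoseEinsteinCondensation.Theorems.BECGroundStateSOSPeriodicIRBoundTwoSectorDefs
import Summits.AtomisticToContinuum.BoseEinsteinCondensation.Theorems.BECGroundStateSOSPeriodicIRBoundTransferArith
import Summits.AtomisticToContinuum.BoseEinsteinCondensation.Theorems.BECGroundStateSOSPeriodicIRBoundWFVariational
import Summits.AtomisticToContinuum.BoseEinsteinCondensation.Theorems.BECFeynmanVortexAreaZeroMomentumGround
import HarnessLib

/-!
# Route `BECGroundStateSOS`, crux `PeriodicIRBound` (stmt-AtomisticToContinuum-3972), line `two-sector-gd-transfer` —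
# stub S5 `stub_windowAssembly : WindowAssembly`

Supports (does not close) stmt-AtomisticToContinuum-3972. The registered stub `stub_windowAssembly` of the skeleton
`Cruxes/PeriodicIRBound/Lines/two_sector_gd_transfer.lean` (statement `WindowAssembly` in
`Theorems/BECGroundStateSOSPeriodicIRBoundTwoSectorDefs.lean`): for ONE integrable admissible potential `v`, the
two-channel susceptibility bound `TwoChannelSusceptibility v K ρ₀ C` (eventually in `N`, both one-particle-transfer
channels at every mode `0 < 2π‖n‖_∞/L ≤ K` of a torus with `(N+1) ≤ ρ₀L³` are bounded by `b = CL²/‖n‖²_∞`), the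
fixed-`(N, L)` Kennedy–Lieb–Shastry moment inequality `KLSMomentFor v` and midpoint near-convexity `ConvexityFor v` of
`N ↦ E₀^per(N, L)` give the crux's infrared inequality `IRBoundFor v`.

Proof (window arithmetic, convexity bookkeeping, scalar endgame). Fix `κ > 0`; with `ρ₁` from convexity (used at
`ε = 1`) put `ρ₀' := min (ρ₀/2) (min ρ₁ ((K/(2πκ))²))` and
`C' := C√a + 2κ + √((12π²C + 1)κ² + 2C‖v‖₁)` (`a` the scattering length, `‖v‖₁ = ∫ v(|x|)dx`). Along
`L = L_N = (N/ρ)^{1/3}` (`L³ = N/ρ`) and for `ρ < ρ₀'`: `ρ₀L³ ≥ 2N ≥ N + 1`, so the two-channel bound applies at `N` and at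
`N − 1` (eventually, `N ≥ N₀ + 2`); a window mode `0 < ‖n‖_∞ ≤ κ√ρL` has `2π‖n‖_∞/L ≤ 2πκ√ρ ≤ K`; `N/L³ = ρ` is in the
density window of convexity; `E₀(N−1), E₀(N), E₀(N+1) < ⊤` for integrable `v`
(`ZeroMomentumGround.periodicGroundStateEnergy_ne_top_of_lintegral_ne_top`). Hence `SuscPlus v N L n b` and
`SuscMinus v (N−1) L n b`, and `KLSMomentFor` at `η_n := min 1 (‖n‖²/(CL²))` (so `bη_n ≤ 1`) yields a slack `δ(n) > 0`;
the slack `δ_N` of the crux is the least `δ(n)` over the finite box containing the window (`Negative.inWindow_mem_box`,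
pattern of `Negative.irBoundWith_of_ground`). For a `δ_N`-near-minimiser `Ψ` and `y = 2n_k + 1`, monotonicity
`E₀(N) ≤ E₀(N+1)` (`WF.periodicGroundStateEnergy_le_succ`) and convexity `2E₀(N) ≤ E₀(N+1) + E₀(N−1) + √(ρa)/L` turn the
energy combination of the moment inequality into `≤ n_k·√(ρa)/L ≤ (√(ρa)/L)·y/2`; `kls_endgame` gives
`y ≤ 2b(1+η)(e/2+η) + √(2b(1+η)(D+η))` with `D ≤ 12π²‖n‖²/L² + 2ρ‖v‖₁` (`|2πn/L|² ≤ 12π²‖n‖²_∞/L²`,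
`TransferArith.norm_latticeVec_eq`), and with `X := √ρL/‖n‖`, `1 ≤ κX` on the window, `η ≤ 1`, `bη ≤ 1`:
`2b(1+η)(e/2+η) ≤ 2be + 4 ≤ 2C√a·X + 4κX`, `2b(1+η)(D+η) ≤ 4(bD + 1) ≤ 4((12π²C+1)κ² + 2C‖v‖₁)X²`, so
`n_k ≤ y/2 ≤ C'X` (`WindowArith.nk_le`). Elementary (real/`ℝ≥0∞` arithmetic and filters); nothing is cited as a fact.
References for the shape only: T. Kennedy, E. H. Lieb, B. S. Shastry, J. Stat. Phys. 53 (1988) 1019, (12)–(14).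
-/

noncomputable section

open scoped BigOperators ENNReal
open Filter MeasureTheory

namespace Summit.AtomisticToContinuum.BoseEinsteinCondensation.Cruxes.PeriodicIRBound.TwoSectorGdTransfer

open Literature.MathematicalPhysics.QuantumManyBody.BoseGas
open Summit.AtomisticToContinuum.BoseEinsteinCondensation.Theorems.PeriodicIRBound.Negative
  (IRBoundFor NearMin InWindow IRIneq irIneq_iff inWindow_mem_box sqrt_nsq_le_sqrt_three_mul_norm)
open Summit.AtomisticToContinuum.BoseEinsteinCondensation.Theorems.GaussianDominationCan.Negative
  (nsq nsq_nonneg one_le_norm_intVec)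
open Summit.AtomisticToContinuum.BoseEinsteinCondensation.Cruxes.PeriodicIRBound.LinearPhFloorWagner
  (TransferArith.norm_latticeVec_eq WF.periodicGroundStateEnergy_le_succ)
open Summit.AtomisticToContinuum.BoseEinsteinCondensation.Theorems.ZeroMomentumGround
  (periodicGroundStateEnergy_ne_top_of_lintegral_ne_top)

/-! ### The scalar endgame over `ℝ` -/

namespace WindowArith

/-- The linear term of `kls_endgame` for `η ≤ 1`, `bη ≤ 1`: `2b(1+η)(e/2+η) ≤ 2be + 4`. [folklore] -/
theorem linear_le {b e η : ℝ} (hb : 0 ≤ b) (he : 0 ≤ e) (hη0 : 0 ≤ η) (hη1 : η ≤ 1) (hbη : b * η ≤ 1) :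
    2 * b * (1 + η) * (e / 2 + η) ≤ 2 * (b * e) + 4 := by
  have h1 : b * e * η ≤ b * e := by nlinarith [mul_nonneg hb he]
  have h2 : b * η * η ≤ 1 := by nlinarith [mul_nonneg hb hη0]
  nlinarith [h1, h2, hbη]

/-- The radicand of `kls_endgame` for `η ≤ 1`, `bη ≤ 1`: `2b(1+η)(D+η) ≤ 4(bD + 1)`. [folklore] -/
theorem radicand_le {b D η : ℝ} (hb : 0 ≤ b) (hD : 0 ≤ D) (hη0 : 0 ≤ η) (hη1 : η ≤ 1) (hbη : b * η ≤ 1) :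
    2 * b * (1 + η) * (D + η) ≤ 4 * (b * D + 1) := by
  have h1 : 2 * b * (1 + η) * (D + η) ≤ 2 * b * 2 * (D + η) := by
    have : 0 ≤ 2 * b * (D + η) := by positivity
    nlinarith [this]
  nlinarith [h1, hbη]

/-- **Convexity bookkeeping**: monotonicity `E₀(N) ≤ E₀(N+1)` and midpoint near-convexity
`2E₀(N) ≤ E₀(N+1) + E₀(N−1) + e` give `E₀(N)(2n_k+1) − E₀(N−1)n_k − E₀(N+1)(n_k+1) ≤ n_k·e ≤ e·(2n_k+1)/2`. [folklore] -/
theorem energyComb_le {e0 e1 e3 e nk : ℝ} (hnk : 0 ≤ nk) (he : 0 ≤ e) (hmono : e0 ≤ e3)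
    (hconv : 2 * e0 ≤ e3 + e1 + e) :
    e0 * (2 * nk + 1) - e1 * nk - e3 * (nk + 1) ≤ e * ((2 * nk + 1) / 2) := by
  nlinarith [mul_le_mul_of_nonneg_left hconv hnk]

/-- From the shape of `KLSMomentFor` to the hypothesis of `kls_endgame` (`y = 2n_k + 1`, `D = εₙ + W`): the energy
combination is replaced by its bound `e·y/2` (`1 + η ≥ 0`, `b ≥ 0`). [folklore] -/
theorem kls_input {nk b η εn W e0 e1 e3 e : ℝ} (hb : 0 ≤ b) (hη0 : 0 ≤ η)
    (hE : e0 * (2 * nk + 1) - e1 * nk - e3 * (nk + 1) ≤ e * ((2 * nk + 1) / 2))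
    (h : (2 * nk + 1) ^ 2 ≤
      2 * b * ((1 + η) * (εn + W + e0 * (2 * nk + 1) - e1 * nk - e3 * (nk + 1)) + η * (2 * nk + 2))) :
    (2 * nk + 1) ^ 2 ≤ 2 * b * ((1 + η) * (εn + W + e * ((2 * nk + 1) / 2)) + η * (2 * nk + 1 + 1)) := by
  have h1 : 2 * b * ((1 + η) * (εn + W + e0 * (2 * nk + 1) - e1 * nk - e3 * (nk + 1))) ≤
      2 * b * ((1 + η) * (εn + W + e * ((2 * nk + 1) / 2))) := by
    apply mul_le_mul_of_nonneg_left _ (by positivity)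
    apply mul_le_mul_of_nonneg_left _ (by positivity)
    linarith
  nlinarith [h1]

/-- **Window scaling of the endgame**: with `b = CL²/‖n‖²`, `η ≤ 1`, `bη ≤ 1`, `D ≤ 12π²‖n‖²/L² + 2ρ‖v‖₁`,
`e ≤ √ρ√a/L` and `1 ≤ ‖n‖ ≤ κ√ρL`, the conclusion `y ≤ 2b(1+η)(e/2+η) + √(2b(1+η)(D+η))` of `kls_endgame` gives
`y/2 ≤ (C√a + 2κ + √((12π²C+1)κ² + 2C‖v‖₁))·√ρL/‖n‖` (all constants are absorbed by `1 ≤ κ√ρL/‖n‖`). [folklore] -/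
theorem half_le {C κ ρ L nn a V₁ b η D e y : ℝ} (hC : 0 < C) (hκ : 0 < κ) (hρ : 0 < ρ) (hL : 0 < L)
    (hn1 : 1 ≤ nn) (hwin : nn ≤ κ * Real.sqrt ρ * L) (hV : 0 ≤ V₁)
    (hb : b = C * L ^ 2 / nn ^ 2) (hη0 : 0 ≤ η) (hη1 : η ≤ 1) (hbη : b * η ≤ 1)
    (hD0 : 0 ≤ D) (hD : D ≤ 12 * Real.pi ^ 2 * nn ^ 2 / L ^ 2 + 2 * ρ * V₁)
    (he0 : 0 ≤ e) (he : e ≤ Real.sqrt ρ * Real.sqrt a / L)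
    (h : y ≤ 2 * b * (1 + η) * (e / 2 + η) + Real.sqrt (2 * b * (1 + η) * (D + η))) :
    y / 2 ≤ (C * Real.sqrt a + 2 * κ + Real.sqrt ((12 * Real.pi ^ 2 * C + 1) * κ ^ 2 + 2 * C * V₁)) *
      Real.sqrt ρ * L / nn := by
  set X : ℝ := Real.sqrt ρ * L / nn with hX
  set A : ℝ := (12 * Real.pi ^ 2 * C + 1) * κ ^ 2 + 2 * C * V₁ with hA
  have hn0 : 0 < nn := one_pos.trans_le hn1
  have hs : 0 < Real.sqrt ρ := Real.sqrt_pos.2 hρ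
  have hX0 : 0 < X := by positivity
  have hA0 : 0 ≤ A := by positivity
  have hκX : 1 ≤ κ * X := by
    rw [hX, ← mul_div_assoc, le_div_iff₀ hn0]
    linarith [hwin]
  have hb0 : 0 ≤ b := by rw [hb]; positivity
  -- the linear term
  have hT1 : 2 * b * (1 + η) * (e / 2 + η) ≤ 2 * (C * Real.sqrt a) * X + 4 * κ * X := by
    have h1 := linear_le hb0 he0 hη0 hη1 hbη
    have h2 : b * e ≤ C * Real.sqrt a * X := by
      calc b * e ≤ b * (Real.sqrt ρ * Real.sqrt a / L) := mul_le_mul_of_nonneg_left he hb0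
        _ = C * Real.sqrt a * X / nn := by
            rw [hb, hX]
            field_simp
        _ ≤ C * Real.sqrt a * X := div_le_self (by positivity) hn1
    have h3 : (4 : ℝ) ≤ 4 * κ * X := by nlinarith [hκX]
    linarith [h1, h2, h3]
  -- the square-root term
  have hT2 : Real.sqrt (2 * b * (1 + η) * (D + η)) ≤ 2 * Real.sqrt A * X := by
    rw [Real.sqrt_le_left (by positivity)]
    have h1 := radicand_le hb0 hD0 hη0 hη1 hbη
    have h2 : (2 * Real.sqrt A * X) ^ 2 = 4 * A * X ^ 2 := by
      rw [mul_pow, mul_pow, Real.sq_sqrt hA0]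
      ring
    rw [h2]
    have hX2 : X ^ 2 = ρ * L ^ 2 / nn ^ 2 := by
      rw [hX, div_pow, mul_pow, Real.sq_sqrt hρ.le]
    have h3 : b * D ≤ 12 * Real.pi ^ 2 * C + 2 * C * V₁ * X ^ 2 := by
      calc b * D ≤ b * (12 * Real.pi ^ 2 * nn ^ 2 / L ^ 2 + 2 * ρ * V₁) :=
            mul_le_mul_of_nonneg_left hD hb0
        _ = 12 * Real.pi ^ 2 * C + 2 * C * V₁ * X ^ 2 := by
            rw [hb, hX2]
            field_simp
    have h4 : 1 ≤ κ ^ 2 * X ^ 2 := by nlinarith [hκX]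
    have h5 : 12 * Real.pi ^ 2 * C ≤ 12 * Real.pi ^ 2 * C * (κ ^ 2 * X ^ 2) :=
      le_mul_of_one_le_right (by positivity) h4
    have h6 : 4 * A * X ^ 2 = 4 * (12 * Real.pi ^ 2 * C * (κ ^ 2 * X ^ 2)) + 4 * (κ ^ 2 * X ^ 2) +
        4 * (2 * C * V₁ * X ^ 2) := by
      rw [hA]
      ring
    rw [h6]
    linarith [h1, h3, h4, h5]
  have hfin : (C * Real.sqrt a + 2 * κ + Real.sqrt A) * Real.sqrt ρ * L / nn =
      (C * Real.sqrt a + 2 * κ + Real.sqrt A) * X := by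
    rw [hX]
    ring
  rw [hfin]
  nlinarith [h, hT1, hT2]

/-- **The endgame for one window mode** (composition of `energyComb_le`, `kls_input`, the Defs module's `kls_endgame`
and `half_le`): the KLS moment inequality at `b = CL²/‖n‖²`, `η ≤ 1` with `bη ≤ 1`, together with monotonicity and
midpoint near-convexity of `E₀`, bounds the occupation: `n_k ≤ C'·√ρL/‖n‖`. [folklore] -/
theorem nk_le {C κ ρ L nn a V₁ η εn W e0 e1 e3 e nk : ℝ} (hC : 0 < C) (hκ : 0 < κ) (hρ : 0 < ρ)
    (hL : 0 < L) (hn1 : 1 ≤ nn) (hwin : nn ≤ κ * Real.sqrt ρ * L) (hV : 0 ≤ V₁)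
    (hη0 : 0 ≤ η) (hη1 : η ≤ 1) (hbη : C * L ^ 2 / nn ^ 2 * η ≤ 1)
    (hD0 : 0 ≤ εn + W) (hD : εn + W ≤ 12 * Real.pi ^ 2 * nn ^ 2 / L ^ 2 + 2 * ρ * V₁)
    (hnk : 0 ≤ nk) (he0 : 0 ≤ e) (he : e ≤ Real.sqrt ρ * Real.sqrt a / L) (hmono : e0 ≤ e3)
    (hconv : 2 * e0 ≤ e3 + e1 + e)
    (h : (2 * nk + 1) ^ 2 ≤ 2 * (C * L ^ 2 / nn ^ 2) *
      ((1 + η) * (εn + W + e0 * (2 * nk + 1) - e1 * nk - e3 * (nk + 1)) + η * (2 * nk + 2))) :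
    nk ≤ (C * Real.sqrt a + 2 * κ + Real.sqrt ((12 * Real.pi ^ 2 * C + 1) * κ ^ 2 + 2 * C * V₁)) *
      Real.sqrt ρ * L / nn := by
  have hb : 0 ≤ C * L ^ 2 / nn ^ 2 := by positivity
  have h1 := kls_input hb hη0 (energyComb_le hnk he0 hmono hconv) h
  have h2 := kls_endgame (y := 2 * nk + 1) (D := εn + W) (by positivity) hb hη0 hD0 he0 h1
  have h3 := half_le hC hκ hρ hL hn1 hwin hV rfl hη0 hη1 hbη hD0 hD he0 he h2
  linarith

end WindowArith

/-! ### The stub -/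

/-- **Stub S5 — window arithmetic, convexity bookkeeping and the scalar endgame.** For an integrable admissible `v`,
the two-channel susceptibility bound with data `(K, ρ₀, C)`, the fixed-`(N, L)` KLS moment inequality and midpoint
near-convexity give the crux's infrared inequality for `v`: for `κ > 0`, densities below
`min (ρ₀/2) (min ρ₁ ((K/(2πκ))²))` and constant `C√a + 2κ + √((12π²C+1)κ² + 2C‖v‖₁)`, eventually in `N` the least KLS
slack over the finite momentum window works (see the module docstring for the proof). [folklore] -/
theorem stub_windowAssembly : WindowAssembly := by
  intro v hv hint K ρ₀ C hK hρ₀ hC hTC hKLS hconv κ hκ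
  obtain ⟨ρ₁, hρ₁, Hconv⟩ := hconv
  obtain ⟨N₀, hN₀⟩ := eventually_atTop.1 hTC
  set V₁ : ℝ := (∫⁻ x : Space, v ‖x‖).toReal with hV₁def
  set a : ℝ := (scatteringLength v).toReal with hadef
  have hV₁ : 0 ≤ V₁ := ENNReal.toReal_nonneg
  refine ⟨min (ρ₀ / 2) (min ρ₁ ((K / (2 * Real.pi * κ)) ^ 2)), by positivity,
    C * Real.sqrt a + 2 * κ + Real.sqrt ((12 * Real.pi ^ 2 * C + 1) * κ ^ 2 + 2 * C * V₁), by positivity,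
    fun ρ hρ hρlt => ?_⟩
  set C' : ℝ := C * Real.sqrt a + 2 * κ + Real.sqrt ((12 * Real.pi ^ 2 * C + 1) * κ ^ 2 + 2 * C * V₁) with hC'
  have hρ1 : ρ < ρ₀ / 2 := hρlt.trans_le (min_le_left _ _)
  have hρ2 : ρ < ρ₁ := hρlt.trans_le ((min_le_right _ _).trans (min_le_left _ _))
  have hρ3 : ρ < (K / (2 * Real.pi * κ)) ^ 2 := hρlt.trans_le ((min_le_right _ _).trans (min_le_right _ _))
  -- the window fits under `K`: `2πκ√ρ ≤ K`
  have hKρ : 2 * Real.pi * κ * Real.sqrt ρ ≤ K := by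
    have h1 : Real.sqrt ρ < K / (2 * Real.pi * κ) := (Real.sqrt_lt' (by positivity)).2 hρ3
    calc 2 * Real.pi * κ * Real.sqrt ρ ≤ 2 * Real.pi * κ * (K / (2 * Real.pi * κ)) :=
          mul_le_mul_of_nonneg_left h1.le (by positivity)
      _ = K := by field_simp
  filter_upwards [eventually_ge_atTop (N₀ + 2), Hconv 1 one_pos ρ hρ hρ2] with N hNN₀ hconvN
  obtain ⟨m, rfl⟩ : ∃ m, N = m + 2 := ⟨N - 2, by omega⟩
  -- notation and side conditions along `L = L_N(ρ)`, `L³ = N/ρ`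
  have hL : 0 < sideLength ρ (m + 2) := sideLength_pos_of_pos hρ (by omega)
  have hL3 : sideLength ρ (m + 2) ^ 3 = ((m + 2 : ℕ) : ℝ) / ρ := sideLength_pow_three hρ (m + 2)
  set L := sideLength ρ (m + 2) with hLdef
  have hfin : ∀ M : ℕ, periodicGroundStateEnergy v M L ≠ ⊤ := fun M =>
    periodicGroundStateEnergy_ne_top_of_lintegral_ne_top hv.1 hint M hL
  have hbig : (m : ℝ) + 3 ≤ ρ₀ * L ^ 3 := by
    rw [hL3, mul_div_assoc', le_div_iff₀ hρ]
    push_cast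
    nlinarith [mul_le_mul_of_nonneg_left hρ1.le (by positivity : (0 : ℝ) ≤ (m : ℝ) + 3),
      mul_nonneg hρ₀.le (m.cast_nonneg (α := ℝ))]
  have hsideN : ((m + 2 : ℕ) : ℝ) + 1 ≤ ρ₀ * L ^ 3 := by push_cast; linarith
  have hsideN' : ((m + 1 : ℕ) : ℝ) + 1 ≤ ρ₀ * L ^ 3 := by push_cast; linarith
  have hne : ((m + 2 : ℕ) : ℝ) ≠ 0 := by positivity
  have hdens : ((m + 2 : ℕ) : ℝ) / L ^ 3 = ρ := by
    rw [hL3, div_div_eq_mul_div, mul_div_cancel_left₀ _ hne]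
  -- the two-channel bound at `N = m + 2` and at `N - 1 = m + 1`, convexity at `N`, monotonicity
  have hTCN := hN₀ (m + 2) (by omega) L hL hsideN (hfin _) (hfin _)
  have hTCN' := hN₀ (m + 1) (by omega) L hL hsideN' (hfin _) (hfin _)
  have he0 : 0 ≤ 1 * Real.sqrt (ρ * a) / L := by positivity
  have he : 1 * Real.sqrt (ρ * a) / L ≤ Real.sqrt ρ * Real.sqrt a / L := by
    rw [one_mul, Real.sqrt_mul hρ.le]
  have hmono : (periodicGroundStateEnergy v (m + 2) L).toReal ≤
      (periodicGroundStateEnergy v (m + 3) L).toReal :=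
    ENNReal.toReal_mono (hfin _) (WF.periodicGroundStateEnergy_le_succ hL hv.1 (m + 2))
  have hconvR : 2 * (periodicGroundStateEnergy v (m + 2) L).toReal ≤
      (periodicGroundStateEnergy v (m + 3) L).toReal + (periodicGroundStateEnergy v (m + 1) L).toReal +
        1 * Real.sqrt (ρ * a) / L := by
    have h := ENNReal.toReal_mono (ENNReal.add_ne_top.2 ⟨ENNReal.add_ne_top.2 ⟨hfin _, hfin _⟩,
      ENNReal.ofReal_ne_top⟩) (hconvN L hL (by rw [hdens]; linarith) (by rw [hdens]; linarith))
    rw [ENNReal.toReal_add (ENNReal.add_ne_top.2 ⟨hfin _, hfin _⟩) ENNReal.ofReal_ne_top,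
      ENNReal.toReal_add (hfin _) (hfin _), ENNReal.toReal_ofReal he0, ENNReal.toReal_mul,
      ENNReal.toReal_ofNat] at h
    exact h
  -- a slack for each mode of the window
  have hk : ∀ n : Fin 3 → ℤ, ∃ δ : ℝ≥0∞, 0 < δ ∧ (InWindow κ ρ (m + 2) n →
      ∀ Ψ : PeriodicTrialState (m + 2) L, NearMinAt v δ Ψ → IRIneq C' ρ (m + 2) Ψ.ψ n) := by
    intro n
    by_cases hnw : InWindow κ ρ (m + 2) n
    · have hn1 : 1 ≤ ‖(fun j => (n j : ℝ))‖ := one_le_norm_intVec hnw.1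
      have hnL : ‖(fun j => (n j : ℝ))‖ ≤ κ * Real.sqrt ρ * L := hnw.2
      set nn : ℝ := ‖(fun j => (n j : ℝ))‖ with hnn
      have hn0 : 0 < nn := one_pos.trans_le hn1
      have hc : 0 < 2 * Real.pi / L := by positivity
      have hnK : 2 * Real.pi / L * nn ≤ K := by
        calc 2 * Real.pi / L * nn ≤ 2 * Real.pi / L * (κ * Real.sqrt ρ * L) :=
              mul_le_mul_of_nonneg_left hnL hc.le
          _ = 2 * Real.pi * κ * Real.sqrt ρ := by field_simp
          _ ≤ K := hKρ
      have hb : 0 ≤ C * L ^ 2 / nn ^ 2 := by positivity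
      obtain ⟨hSP, -⟩ := hTCN n hnw.1 hnK
      obtain ⟨-, hSM⟩ := hTCN' n hnw.1 hnK
      have hη : 0 < min 1 (nn ^ 2 / (C * L ^ 2)) := lt_min one_pos (by positivity)
      obtain ⟨δ, hδ, hδspec⟩ := hKLS m L hL (hfin _) (hfin _) (hfin _) n hnw.1 _ hb hSP hSM _ hη
      refine ⟨δ, hδ, fun _ Ψ hΨ => ?_⟩
      have hocc : cellOccupation (m + 2) L (planeWaveMode L n) Ψ.ψ ≠ ⊤ :=
        ne_top_of_le_ne_top (ENNReal.natCast_ne_top _) (Ψ.cellOccupation_planeWaveMode_le hL n)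
      have hbη : C * L ^ 2 / nn ^ 2 * min 1 (nn ^ 2 / (C * L ^ 2)) ≤ 1 := by
        calc C * L ^ 2 / nn ^ 2 * min 1 (nn ^ 2 / (C * L ^ 2))
            ≤ C * L ^ 2 / nn ^ 2 * (nn ^ 2 / (C * L ^ 2)) := mul_le_mul_of_nonneg_left (min_le_right _ _) hb
          _ = 1 := by field_simp
      have hD0 : 0 ≤ ‖latticeVec (2 * Real.pi / L) n‖ ^ 2 + 2 * ((m : ℝ) + 2) * V₁ / L ^ 3 := by
        positivity
      have hD : ‖latticeVec (2 * Real.pi / L) n‖ ^ 2 + 2 * ((m : ℝ) + 2) * V₁ / L ^ 3 ≤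
          12 * Real.pi ^ 2 * nn ^ 2 / L ^ 2 + 2 * ρ * V₁ := by
        have h1 : ‖latticeVec (2 * Real.pi / L) n‖ ^ 2 ≤ 12 * Real.pi ^ 2 * nn ^ 2 / L ^ 2 := by
          rw [TransferArith.norm_latticeVec_eq, abs_of_pos hc]
          have h3 : Real.sqrt (nsq n) ≤ Real.sqrt 3 * nn := sqrt_nsq_le_sqrt_three_mul_norm n
          calc (2 * Real.pi / L * Real.sqrt (nsq n)) ^ 2 ≤ (2 * Real.pi / L * (Real.sqrt 3 * nn)) ^ 2 :=
                pow_le_pow_left₀ (by positivity) (mul_le_mul_of_nonneg_left h3 hc.le) 2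
            _ = 12 * Real.pi ^ 2 * nn ^ 2 / L ^ 2 := by
                rw [mul_pow, mul_pow, Real.sq_sqrt (by norm_num : (0 : ℝ) ≤ 3)]
                field_simp
                ring
        have h2 : 2 * ((m : ℝ) + 2) * V₁ / L ^ 3 = 2 * ρ * V₁ := by
          have hm : (m : ℝ) + 2 ≠ 0 := by positivity
          rw [hL3]
          push_cast
          field_simp
        linarith
      have hkls := hδspec Ψ hΨ
      rw [← hV₁def] at hkls
      have key := WindowArith.nk_le hC hκ hρ hL hn1 hnL hV₁ hη.le (min_le_left _ _) hbη hD0 hD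
        ENNReal.toReal_nonneg he0 he hmono hconvR hkls
      rw [irIneq_iff]
      exact (ENNReal.ofReal_toReal hocc).symm.le.trans (ENNReal.ofReal_le_ofReal key)
    · exact ⟨1, one_pos, fun h => (hnw h).elim⟩
  choose δf hδf hprop using hk
  -- the least slack over the finite box containing the window
  set W : Finset (Fin 3 → ℤ) := Fintype.piFinset fun _ : Fin 3 =>
      Finset.Icc (-((⌈κ * Real.sqrt ρ * L⌉₊ : ℕ) : ℤ)) ((⌈κ * Real.sqrt ρ * L⌉₊ : ℕ) : ℤ) with hW
  have hW0 : (0 : Fin 3 → ℤ) ∈ W := by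
    rw [hW, Fintype.mem_piFinset]
    intro j
    simp
  have hWne : W.Nonempty := ⟨0, hW0⟩
  refine ⟨W.inf' hWne δf, (Finset.lt_inf'_iff hWne).2 fun k _ => hδf k, fun Ψ hΨ k hkw => ?_⟩
  have hmem : k ∈ W := inWindow_mem_box hkw
  exact hprop k hkw Ψ (hΨ.trans (add_le_add le_rfl (Finset.inf'_le _ hmem)))

end Summit.AtomisticToContinuum.BoseEinsteinCondensation.Cruxes.PeriodicIRBound.TwoSectorGdTransfer

end
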